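import Summits.ValiantsHypothesis.ValiantsHypothesis.Theses.KPlusLogSqLaw
import Summits.ValiantsHypothesis.ValiantsHypothesis.Theorems.KPlusLogSqLawWeakLiftingBridge
import Summits.ValiantsHypothesis.ValiantsHypothesis.Theorems.LacunarySymmetroidMatrixDescartesCensusFrame

/-!
# Line `local-lifting` — crux `WeakLifting` (stmt-ValiantsHypothesis-19561, route KPlusLogSqLaw)

val-idea-4 (o-minimal / fewnomial lens), upgrade of the crux idea `local-multiplicity-law`
(Cruxes/MatrixDescartes/Ideas/local-multiplicity-law.md) to a D-0145 line, as priced by critics 1/2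
(2026-08-27T23:09Z/23:10Z): the untyped K2 («cluster lemma») is typed here as `LocalLifting`, and the
composition reaches `WeakLifting`, `KPlusLogSqLaw` (census currency) and `ValiantsHypothesis` BY NAME.

Khovanskii–Rolle bookkeeping splits a real-zero count into LOCAL capacity (order of coalescence at a
point) and GLOBAL, scale-separated excess.  For lacunary symmetric pencils `F(t) = Σ_l t^{d_l} S_l`:
* LOCAL census `μ(m,K)` := max multiplicity of a non-zero root of `det F ≢ 0` (`LocalRootLawAt`);
  conjecturally parameter-counted: `μ(m,K) ≤ K·m(m+1)/2` (`LocalParamLaw`; the sharp expectation is the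
  gauge-reduced count `K·m(m+1)/2 − m²`, the constant of the refuted distinct-root dimension law, now one
  derivative down where its (2,4) killers — nine SIMPLE, non-coalescible roots — confirm it: apex Gram
  rank 4 > 3, exact);
* GLOBAL excess = the tropical census `T(m,K)` (`TropRootLawAt`, the route's `TropicalB` side);
* the bridge `LocalLifting`: real census ≤ (local census + 2) · (tropical census + 1) — every cluster of
  real roots attached to one dominance-alternation event carries at most `μ + 1` of them (+1 slack for the
  event-free end).  This is WeakLifting with its amplitude PINNED to an independently measurable,
  polynomial quantity; it is falsifiable separately (instrument: level-`r` Gram test per support at m = 2,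
  exact, minutes) and it predicts the lifting loss is `poly(K·m)`, not `2^{Θ(K + log² m)}`.

Stubs (sorries ONLY here): `stub_localParam` (M/L: independence of the `r` Taylor conditions on the
congruence-reduced parameter space — real algebraic geometry), `stub_localLifting` (the crux-sized one).
Everything else is proved: `polyWeakLifting_of`, `factor_le`, `WeakLifting_of` (concludes the crux BY
NAME), `KPlusLogSqLaw_of`, `valiant_of`.

HONEST FRAMING: typing and arithmetic only; no evidence for B, MDR, a door, or VP ≠ VNP, which a format
law does not move.  `LocalLifting` is at least as hard as `WeakLifting` restricted to the formats where
`μ` is known; the ROLLE-INFLATION barrier (val-idea-4 NOTES) says it cannot be proved by a Descartes-counted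
Rolle induction.
-/

set_option linter.dupNamespace false
set_option autoImplicit false

namespace Summit.ValiantsHypothesis.ValiantsHypothesis.Cruxes.WeakLifting.LocalLifting

open Polynomial
open Summit.ValiantsHypothesis.ValiantsHypothesis.Theorems.LacunarySymmetroidMatrixDescartes
open Summit.ValiantsHypothesis.ValiantsHypothesis.Theorems.LacunarySymmetroidMatrixDescartes.TropicalCensus

/-! ## Vocabulary -/

/-- The determinant polynomial of the lacunary pencil (verbatim the term inside `RealRootLawAt`). -/
noncomputable def pencilDet {m K : ℕ} (d : Fin K → ℕ) (S : Fin K → Matrix (Fin m) (Fin m) ℝ) :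
    Polynomial ℝ :=
  Matrix.det (∑ l, ((Polynomial.X : Polynomial ℝ) ^ d l) • (S l).map Polynomial.C)

/-- **Local root law at format `(m,K)`** (the LOCAL census row `μ(m,K) ≤ B`): every symmetric pencil of the
format with `det ≢ 0` vanishes at `t = 1` to order at most `B` (`t = 1` is w.l.o.g. for a non-zero root:
`t ↦ t₀ u` stays in the format). -/
def LocalRootLawAt (m K B : ℕ) : Prop :=
  ∀ (d : Fin K → ℕ) (S : Fin K → Matrix (Fin m) (Fin m) ℝ), (∀ l, (S l).IsSymm) →
    pencilDet d S ≠ 0 → (pencilDet d S).rootMultiplicity 1 ≤ B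

/-- **Local parameter law** (conjecture of this line; instrument-backed at (2,3), (2,4), (2,5)):
`μ(m,K) ≤ K · m(m+1)/2` (the number of free entries). -/
def LocalParamLaw : Prop :=
  ∀ m K : ℕ, LocalRootLawAt m K (K * (m * (m + 1) / 2))

/-- **Local lifting** (the crux-sized stub): real census ≤ (local census + 2) · (tropical census + 1). -/
def LocalLifting : Prop :=
  ∀ m K n B : ℕ, TropRootLawAt m K n → LocalRootLawAt m K B → RealRootLawAt m K ((B + 2) * (n + 1))

/-- **Polynomial-amplitude weak lifting** (critic 1's requested typing, 2026-08-27T23:10Z):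
`TropRootLawAt m K n → RealRootLawAt m K ((K·m(m+1)/2 + 2)·(n+1))`.  A COROLLARY of the two stubs. -/
def PolyWeakLifting : Prop :=
  ∀ m K n : ℕ, TropRootLawAt m K n → RealRootLawAt m K ((K * (m * (m + 1) / 2) + 2) * (n + 1))

/-! ## Stubs (sorries live ONLY here) -/

/-- STUB (M/L): the local parameter law. -/
theorem stub_localParam : LocalParamLaw := by
  sorry

/-- STUB (the hard one): local lifting. -/
theorem stub_localLifting : LocalLifting := by
  sorry

/-! ## Composition (no sorry below) -/

theorem localRootLawAt_mono {m K B B' : ℕ} (h : LocalRootLawAt m K B) (hBB' : B ≤ B') :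
    LocalRootLawAt m K B' :=
  fun d S hS h0 => (h d S hS h0).trans hBB'

theorem polyWeakLifting_of (hP : LocalParamLaw) (hL : LocalLifting) : PolyWeakLifting :=
  fun m K n hT => hL m K n _ hT (hP m K)

/-- the amplitude is inside Conjecture B's budget: `K·m(m+1)/2 + 2 ≤ 2^{4(K + ⌊log₂ m⌋²)}` for `K ≥ 1`. -/
theorem factor_le (m K : ℕ) (hK : 1 ≤ K) :
    K * (m * (m + 1) / 2) + 2 ≤ 2 ^ (4 * (K + Nat.log 2 m ^ 2)) := by
  set L := Nat.log 2 m with hL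
  have hm : m < 2 ^ (L + 1) := Nat.lt_pow_succ_log_self (by norm_num) m
  have h1 : m * (m + 1) / 2 ≤ 2 ^ (2 * L + 2) :=
    calc m * (m + 1) / 2 ≤ m * (m + 1) := Nat.div_le_self _ _
      _ ≤ 2 ^ (L + 1) * 2 ^ (L + 1) := Nat.mul_le_mul hm.le (Nat.succ_le_of_lt hm)
      _ = 2 ^ (2 * L + 2) := by rw [← pow_add]; ring_nf
  have hK2 : K ≤ 2 ^ K := (Nat.lt_two_pow_self).le
  have h2 : K * (m * (m + 1) / 2) ≤ 2 ^ (K + (2 * L + 2)) := by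
    rw [pow_add]; exact Nat.mul_le_mul hK2 h1
  have h3 : 2 ≤ 2 ^ (K + (2 * L + 2)) :=
    calc 2 = 2 ^ 1 := by norm_num
      _ ≤ 2 ^ (K + (2 * L + 2)) := Nat.pow_le_pow_right (by norm_num) (by omega)
  calc K * (m * (m + 1) / 2) + 2 ≤ 2 ^ (K + (2 * L + 2)) + 2 ^ (K + (2 * L + 2)) := Nat.add_le_add h2 h3
    _ = 2 ^ (K + (2 * L + 2) + 1) := by rw [pow_succ]; ring
    _ ≤ 2 ^ (4 * (K + L ^ 2)) := Nat.pow_le_pow_right (by norm_num) (by nlinarith)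

/-- **The line's composition, part 1**: the crux `WeakLifting`, BY NAME, from the two stubs' statements. -/
theorem weakLifting_of_stubs (hP : LocalParamLaw) (hL : LocalLifting) :
    Summit.ValiantsHypothesis.ValiantsHypothesis.Theses.KPlusLogSqLaw.WeakLifting := by
  refine ⟨4, fun m K n hT => ?_⟩
  rcases Nat.eq_zero_or_pos K with hK | hK
  · subst hK; exact realRootLawAt_zero m _
  · exact Census.realRootLawAt_mono (Nat.mul_le_mul_right _ (factor_le m K hK))
      (polyWeakLifting_of hP hL m K n hT)

/-- **The crux, by name, from the stubs.** -/
theorem WeakLifting_of : Summit.ValiantsHypothesis.ValiantsHypothesis.Theses.KPlusLogSqLaw.WeakLifting :=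
  weakLifting_of_stubs stub_localParam stub_localLifting

/-- **Part 2** (critic 1's requested shape): `PolyWeakLifting → TropicalB → KPlusLogSqLaw` (census currency). -/
theorem kPlusLogSqLaw_of_polyWeakLifting (hW : PolyWeakLifting)
    (hT : Summit.ValiantsHypothesis.ValiantsHypothesis.Theses.KPlusLogSqLaw.TropicalB) : KPlusLogSqLaw := by
  refine kPlusLogSqLaw_of_weakLifting_of_tropKPlusLogSqLaw ⟨4, fun m K n hTr => ?_⟩ hT
  rcases Nat.eq_zero_or_pos K with hK | hK
  · subst hK; exact realRootLawAt_zero m _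
  · exact Census.realRootLawAt_mono (Nat.mul_le_mul_right _ (factor_le m K hK)) (hW m K n hTr)

theorem KPlusLogSqLaw_of (hT : Summit.ValiantsHypothesis.ValiantsHypothesis.Theses.KPlusLogSqLaw.TropicalB) :
    KPlusLogSqLaw :=
  kPlusLogSqLaw_of_polyWeakLifting (polyWeakLifting_of stub_localParam stub_localLifting) hT

/-- **Part 3**: with the route's other crux `TropicalB`, the route's `closes` gives the summit decl. -/
theorem valiant_of (hT : Summit.ValiantsHypothesis.ValiantsHypothesis.Theses.KPlusLogSqLaw.TropicalB) :
    _root_.ValiantsHypothesis :=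
  Summit.ValiantsHypothesis.ValiantsHypothesis.Theses.KPlusLogSqLaw.closes hT WeakLifting_of

end Summit.ValiantsHypothesis.ValiantsHypothesis.Cruxes.WeakLifting.LocalLifting
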